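import Summits.QuantumAdvantage.QuantumAdvantage.Theses.DarkClassGroups
import Literature.NumberTheory.QuadraticFields.RingClassForms
import Literature.NumberTheory.QuadraticFields.RingClassUnits
import Literature.NumberTheory.QuadraticFields.ClassNumberOneGenus
import Literature.Computability.Cryptography.HallgrenClassGroupDiscriminant

/-!
# `DarkClassGroups.OrderClassNumberFormula` (stmt-QuantumAdvantage-17900), registered stub S1
# `stub_picardIndex`: `h(−df²)·w(−d)·φ(f) = h(−d)·w(−df²)·|(𝓞 K/f𝓞 K)ˣ|` (Cox, Thm. 7.24, index form)

The load-bearing stub of the planner's line `cox-conductor` (Cruxes/ClassNumberFBQP/Lines/cox_conductor.lean)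
for the crux `OrderClassNumberFormula` of route `DarkClassGroups`, proved from the tree's ring class
group files (all PROVED):

* `RingClassForms.classNumber_eq_card_ringClassGroup` — `h(f²d_K) = |I_K(f)/P_{K,ℤ}(f)|`
  (Cox Thm. 7.7 + Prop. 7.22);
* `RingClassNumber.card_ringClassGroup_mul` — `|I_K(f)/P_{K,ℤ}(f)|·|𝓞 Kˣ|·φ(f) = |(𝓞 K/f)ˣ|·|range|·|𝒪ˣ|`
  (Cox (7.25)–(7.27));
* `RingClassForms.toClassGroup_surjective` — the range is all of `Cl(𝓞 K)` (`= h(−d)` classes,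
  `IsNegFundamentalDiscr.classNumber_eq_card_classGroup`);
* `RingClassUnits.card_units_eq`, `card_orderUnits_eq_two` — the unit counts `w(−d) ∈ {2,4,6}`,
  `w(−df²) = 2` for `f ≥ 2`.

HONEST FRAMING (block-2b rule): the value here is a THEOREM (a registered stub of an open crux,
kernel-checked; Cox's Thm. 7.24 is classical and NOT in Mathlib) — NOT summit progress.

References: D. A. Cox, *Primes of the form x² + ny²*, 2nd ed. (2013), §7.D Thm. 7.24 [Cox2013].
-/

set_option linter.dupNamespace false -- D-0017: single-problem summit ⇒ `QuantumAdvantage.QuantumAdvantage` by design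

noncomputable section

namespace Summit.QuantumAdvantage.QuantumAdvantage.Theorems.OrderClassNumberFormula

open NumberField
open Literature.NumberTheory.QuadraticFields
open Literature.NumberTheory.QuadraticFields.RingClass
open Literature.NumberTheory.QuadraticFields.Quadratic
open Literature.Computability.Cryptography
open Literature.Computability.Cryptography.Hallgren2005.OrderCl

/-- The units of the zero ring `𝓞 K / (1)` form a one-element group. [folklore] -/
theorem natCard_units_quot_span_one (K : Type) [Field K] [NumberField K] :
    Nat.card (𝓞 K ⧸ Ideal.span {((1 : ℕ) : 𝓞 K)})ˣ = 1 := by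
  have htop : Ideal.span {((1 : ℕ) : 𝓞 K)} = ⊤ := by simp
  haveI : Subsingleton (𝓞 K ⧸ Ideal.span {((1 : ℕ) : 𝓞 K)}) :=
    Ideal.Quotient.subsingleton_iff.2 htop
  haveI : Unique (𝓞 K ⧸ Ideal.span {((1 : ℕ) : 𝓞 K)})ˣ := uniqueOfSubsingleton 1
  exact Nat.card_unique

/-- **S1 `stub_picardIndex` of line `cox-conductor`** (crux `DarkClassGroups.OrderClassNumberFormula`,
stmt-QuantumAdvantage-17900): for `−d` a negative fundamental discriminant, `f ≥ 1` and a quadratic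
field `K` of discriminant `−d`,
`h(−d f²) · w(−d) · φ(f) = h(−d) · w(−d f²) · |(𝓞 K / f 𝓞 K)ˣ|`
(Cox, Thm. 7.24 in index form: `h(𝒪) = h(𝒪_K)·|(𝒪_K/f)ˣ| / (φ(f) [𝒪_Kˣ : 𝒪ˣ])`).
[cite: Cox2013, §7.D Thm. 7.24] -/
theorem stub_picardIndex : ∀ d f : ℕ, Literature.Computability.Cryptography.IsNegFundamentalDiscr d → 1 ≤ f →
    ∀ (K : Type) [Field K] [NumberField K], Module.finrank ℚ K = 2 → NumberField.discr K = -(d : ℤ) →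
      (Literature.NumberTheory.QuadraticFields.BinaryQuadraticForm.classNumber (-((d * f ^ 2 : ℕ) : ℤ)) : ℤ) * (if d = 3 then 6 else if d = 4 then 4 else 2) * (Nat.totient f : ℤ) = (Literature.NumberTheory.QuadraticFields.BinaryQuadraticForm.classNumber (-(d : ℤ)) : ℤ) * (if d * f ^ 2 = 3 then 6 else if d * f ^ 2 = 4 then 4 else 2) * (Nat.card ((NumberField.RingOfIntegers K ⧸ Ideal.span {((f : ℕ) : NumberField.RingOfIntegers K)})ˣ) : ℤ) := by
  intro d f hd hf K _ _ h2 hdisc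
  have hd3 := hd.three_le
  -- the case `f = 1` is trivial
  rcases Nat.lt_or_ge 1 f |>.symm with hf1 | hf2
  · have : f = 1 := le_antisymm hf1 hf
    subst this
    simp only [pow_two, mul_one, Nat.totient_one, Nat.cast_one, natCard_units_quot_span_one K]
  -- `f ≥ 2`: integral basis `(1, ω)`, `ω² = m + tω`, `t² + 4m = d_K = −d`
  obtain ⟨b, hb⟩ := exists_basis_zero_eq_one h2
  set m : ℤ := b.repr (b 1 * b 1) 0 with hm
  set t : ℤ := b.repr (b 1 * b 1) 1 with ht
  have hω : b 1 * b 1 = (m : 𝓞 K) + (t : 𝓞 K) * b 1 := basis_one_mul_self_eq b hb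
  have hdK : NumberField.discr K = t ^ 2 + 4 * m := discr_eq_sq_add_four_mul b hb
  have hneg : t ^ 2 + 4 * m < 0 := by rw [← hdK, hdisc]; have := hd.neg_lt_zero; exact this
  have hf0 : f ≠ 0 := by omega
  -- the order of discriminant `D = −d f² = f² d_K`
  have hDneg : (-((d * f ^ 2 : ℕ) : ℤ)) < 0 := by
    have : 0 < d * f ^ 2 := Nat.mul_pos (by omega) (pow_pos (by omega) 2)
    omega
  set Δ : NegDiscr := ⟨-((d * f ^ 2 : ℕ) : ℤ), hDneg⟩ with hΔ
  have hD : Δ.D = (f : ℤ) ^ 2 * (t ^ 2 + 4 * m) := by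
    simp only [hΔ]; rw [← hdK, hdisc]; push_cast; ring
  obtain ⟨s, hs'⟩ := two_dvd_sub hD
  have hs : 2 * s = Δ.D - f * t := hs'.symm
  obtain ⟨ι, hι⟩ := exists_ringHom b hω hD hs
  have hftop : Ideal.span {(f : 𝓞 K)} ≠ ⊤ := by
    intro htop
    have h1 : ((1 : ℤ) : 𝓞 K) ∈ Ideal.span {(f : 𝓞 K)} := by rw [htop]; exact Submodule.mem_top
    rw [intCast_mem_span_iff b hb] at h1
    have : (f : ℤ) ≤ 1 := Int.le_of_dvd one_pos h1
    omega
  -- the four inputs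
  have hforms := classNumber_eq_card_ringClassGroup b hb hω hD ι hι hf0 hftop
  have hbridge := BinaryQuadraticForm.binQF_classNumber_eq Δ.D Δ.neg
  have hcount := card_ringClassGroup_mul b hb hω hftop hf0
  have hrange : Nat.card (toClassGroup K f).range =
      Literature.NumberTheory.QuadraticFields.BinaryQuadraticForm.classNumber (-(d : ℤ)) := by
    rw [MonoidHom.range_eq_top.2 (toClassGroup_surjective b hb hω hneg hf0), Subgroup.card_top,
      Nat.card_eq_fintype_card, hd.classNumber_eq_card_classGroup h2 hdisc]
  have hunits : Nat.card (𝓞 K)ˣ = if d = 3 then 6 else if d = 4 then 4 else 2 := by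
    rw [card_units_eq b hb hω hneg]
    have e : t ^ 2 + 4 * m = -(d : ℤ) := by rw [← hdK, hdisc]
    rw [e]
    by_cases h3 : d = 3
    · simp [h3]
    · by_cases h4 : d = 4
      · simp [h4]
      · rw [if_neg (by omega), if_neg (by omega), if_neg h3, if_neg h4]
  have horder := card_orderUnits_eq_two b hb hω hneg hf2
  have hw2 : (if d * f ^ 2 = 3 then (6 : ℤ) else if d * f ^ 2 = 4 then 4 else 2) = 2 := by
    have : 12 ≤ d * f ^ 2 := by nlinarith
    rw [if_neg (by omega), if_neg (by omega)]
  -- assemble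
  rw [hw2]
  have hΔD : Δ.D = -((d * f ^ 2 : ℕ) : ℤ) := rfl
  rw [← hΔD, ← hbridge, hforms, ← hrange]
  rw [hunits, horder] at hcount
  have hcountZ := congrArg (Nat.cast : ℕ → ℤ) hcount
  push_cast at hcountZ ⊢
  linarith [hcountZ]

end Summit.QuantumAdvantage.QuantumAdvantage.Theorems.OrderClassNumberFormula

end
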